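import Summits.Ventures.PercRepro.ProfileGapMonoThresholdTopNuTwo
import Summits.Ventures.PercRepro.ProfileGapMonoThresholdTopLongFlatCount

/-!
# PercRepro — THE TOP THRESHOLD OF THE CO-RANK-`q` THRESHOLD FAMILY HOLDS ON EVERY COLOOP-FREE MATROID WITH A
RANK-`(q−1)` FLAT OF `ν + q − 2` POINTS, FOR EVERY `q ≥ 2` (p5, gen 30; `proofs/P5-GM1.md` §41(h); announced
INBOX 13953)

The `q = 4` theorem of ProfileGapMonoThresholdTopNuTwo uniformly in `q`: with the counts of
ProfileGapMonoThresholdTopLongFlatCount (`A + s · Bℓ` demanding sets, `s · A₂ + C(s,2) · (Bℓ or C₂)` targets;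
`s = #O = ρ(E) − q + 2`), complementation `D ↦ F ∖ D` gives `Bℓ ≤ A₂`, `A ≤ A₂` and `A = C₂` at `s = 2`, and the
inequality `(s + q − 2)(A + s·Bℓ) ≤ q(s·A₂ + C(s,2)·Bℓ)` holds for `s ≥ 3` because its worst case `A = Bℓ = A₂`
reads `2(s + q − 2) ≤ q s`, i.e. `(q − 2)(s − 2)(s + 1) ≥ 0` (`top_arith`); `s = 2` is `Bℓ ≤ A₂` alone.
**`thresholdIneq_top_of_long_flat`** — `ThresholdIneq N q (ρ(E) − 1)`:
`Σ_{ρ(B) = q−1, E ∖ B spanning} ρ(E) ≤ q · #{S : ρ(S) = q, ρ(E ∖ S) ≥ ρ(E) − 1}`.  At `q = 3` this is the top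
threshold of the long-line case of §37–§38 (already inside `thresholdIneq_three_all`); at `q = 4` it is
`thresholdIneq_four_top_of_long_plane`; at `q ≥ 5` it is new.  Nothing open is asserted.
-/

open scoped Matroid

namespace PercRepro.Cogirth

open Finset ThmH Skew Shadow Profile

variable {α : Type} [DecidableEq α] {N : Matroid α} [N.Finite]

section TopLongFlat

variable {q : ℕ}

/-- **`Bℓ ≤ A₂` by complementation**, co-rank `q`. -/
theorem card_Bl_le_A2' (B : Finset α) :
    ((clF N B).powerset.filter (fun D => rk N D = q - 2 ∧ rk N (clF N B \ D) = q - 1)).card ≤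
      ((clF N B).powerset.filter (fun D => rk N D = q - 1 ∧ q - 2 ≤ rk N (clF N B \ D))).card := by
  apply card_le_card_of_injOn (fun D => clF N B \ D)
  · intro D hD
    simp only [coe_filter, Set.mem_setOf_eq, mem_powerset] at hD ⊢
    obtain ⟨hDF, h2, h3⟩ := hD
    refine ⟨sdiff_subset, h3, ?_⟩
    rw [Finset.sdiff_sdiff_eq_self hDF, h2]
  · intro D₁ hD₁ D₂ hD₂ heq
    simp only [coe_filter, Set.mem_setOf_eq, mem_powerset] at hD₁ hD₂
    simp only at heq
    rw [← Finset.sdiff_sdiff_eq_self hD₁.1, heq, Finset.sdiff_sdiff_eq_self hD₂.1]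

/-- **`A ≤ A₂`**, co-rank `q`: `ρ(O ∪ (F ∖ D)) = #O + (q − 2)` forces `ρ(F ∖ D) ≥ q − 2`. -/
theorem card_A_le_A2' (B : Finset α) (hs : (gr N \ clF N B).card + (q - 2) = rk N (gr N)) :
    ((clF N B).powerset.filter
        (fun D => rk N D = q - 1 ∧ rk N ((gr N \ clF N B) ∪ (clF N B \ D)) = rk N (gr N))).card ≤
      ((clF N B).powerset.filter (fun D => rk N D = q - 1 ∧ q - 2 ≤ rk N (clF N B \ D))).card := by
  apply card_le_card
  intro D hD
  rw [mem_filter] at hD ⊢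
  obtain ⟨hDF, h3, hO⟩ := hD
  refine ⟨hDF, h3, ?_⟩
  have h1 := rk_union_le (M := N) (gr N \ clF N B) (clF N B \ D)
  have h2 := rk_le_card (M := N) (gr N \ clF N B)
  omega

/-- **`A = C₂` when `ρ(E) = q`** (`s = 2`), by complementation. -/
theorem card_A_eq_C2' (B : Finset α) (hR : rk N (gr N) = q) :
    ((clF N B).powerset.filter
        (fun D => rk N D = q - 1 ∧ rk N ((gr N \ clF N B) ∪ (clF N B \ D)) = rk N (gr N))).card =
      ((clF N B).powerset.filter
        (fun D => rk N ((gr N \ clF N B) ∪ D) = q ∧ rk N (clF N B \ D) = q - 1)).card := by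
  apply card_bij (fun D _ => clF N B \ D)
  · intro D hD
    rw [mem_filter, mem_powerset] at hD ⊢
    obtain ⟨hDF, h3, hO⟩ := hD
    refine ⟨sdiff_subset, ?_, ?_⟩
    · rw [← hR]; exact hO
    · rw [Finset.sdiff_sdiff_eq_self hDF, h3]
  · intro D₁ hD₁ D₂ hD₂ heq
    rw [mem_filter, mem_powerset] at hD₁ hD₂
    rw [← Finset.sdiff_sdiff_eq_self hD₁.1, heq, Finset.sdiff_sdiff_eq_self hD₂.1]
  · intro D' hD'
    rw [mem_filter, mem_powerset] at hD'
    obtain ⟨hD'F, h4, h3⟩ := hD'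
    refine ⟨clF N B \ D', ?_, Finset.sdiff_sdiff_eq_self hD'F⟩
    rw [mem_filter, mem_powerset]
    refine ⟨sdiff_subset, h3, ?_⟩
    rw [Finset.sdiff_sdiff_eq_self hD'F, hR]
    exact h4

/-- **The threshold sum at the top threshold**, co-rank `q`: `ρ(E)` times the number of rank-`(q−1)` sets with
spanning complement (`1 ≤ ρ(E)`). -/
theorem thresholdSum_top_eq' (N : Matroid α) [N.Finite] (q : ℕ) (hR : 1 ≤ rk N (gr N)) :
    thresholdSum N q (rk N (gr N) - 1) =
      rk N (gr N) * ((Rq N (q - 1)).filter (fun X => rk N (gr N \ X) = rk N (gr N))).card := by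
  unfold thresholdSum
  have hcongr : ∀ B ∈ Rq N (q - 1),
      (if rk N (gr N) - 1 + 1 ≤ rk N (gr N \ B) then rk N (gr N \ B) else 0) =
        if rk N (gr N \ B) = rk N (gr N) then rk N (gr N) else 0 := by
    intro B _
    have hle : rk N (gr N \ B) ≤ rk N (gr N) := rk_mono' sdiff_subset
    by_cases h : rk N (gr N \ B) = rk N (gr N)
    · rw [if_pos h, if_pos (by omega)]
      exact h
    · rw [if_neg h, if_neg (by omega)]
  rw [sum_congr rfl hcongr, ← sum_filter, sum_const, smul_eq_mul, mul_comm]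

omit [DecidableEq α] in
/-- **The arithmetic of the top threshold for `s = m + 3 ≥ 3`, `q = n + 2 ≥ 2`**:
`(s + q − 2)(A + s·Bℓ) ≤ q(s·A₂ + C(s,2)·Bℓ)` from `A ≤ A₂`, `Bℓ ≤ A₂` and `2·C(s,2) = s(s − 1)`. -/
theorem top_arith (m n A A2 Bl C : ℕ) (hA : A ≤ A2) (hB : Bl ≤ A2) (hc : 2 * C = (m + 3) * (m + 2)) :
    (m + 3 + n) * (A + (m + 3) * Bl) ≤ (n + 2) * ((m + 3) * A2 + C * Bl) := by
  have h1 : (m + 3 + n) * A ≤ (m + 3 + n) * A2 := Nat.mul_le_mul_left _ hA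
  have h2 : (n * m + 2 * n + m + 3) * Bl ≤ (n * m + 2 * n + m + 3) * A2 := Nat.mul_le_mul_left _ hB
  have key : 2 * ((m + 3 + n) * (A + (m + 3) * Bl)) ≤ 2 * ((n + 2) * ((m + 3) * A2 + C * Bl)) := by
    have e : 2 * ((n + 2) * ((m + 3) * A2 + C * Bl)) =
        2 * (n + 2) * (m + 3) * A2 + (n + 2) * ((m + 3) * (m + 2)) * Bl := by
      rw [← hc]; ring
    rw [e]
    nlinarith [h1, h2, Nat.zero_le (n * m * m * Bl), Nat.zero_le (n * m * Bl), Nat.zero_le (n * Bl)]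
  exact Nat.le_of_mul_le_mul_left key (by norm_num)

/-- **THE TOP THRESHOLD OF THE CO-RANK-`q` FAMILY ON A MATROID WITH A RANK-`(q−1)` FLAT OF `ν + q − 2` POINTS**,
for every `q ≥ 2`: for a coloop-free `N` of rank `ρ(E) ≥ q` with `B ∈ Rq N (q − 1)` and
`#(cl B) + ρ(E) = #E + (q − 2)`, `ThresholdIneq N q (ρ(E) − 1)`. -/
theorem thresholdIneq_top_of_long_flat (hq : 2 ≤ q) (hcf : ∀ z ∈ gr N, rk N ((gr N).erase z) = rk N (gr N))
    {B : Finset α} (hB : B ∈ Rq N (q - 1)) (hlong : (clF N B).card + rk N (gr N) = (gr N).card + (q - 2))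
    (hR : q ≤ rk N (gr N)) : ThresholdIneq N q (rk N (gr N) - 1) := by
  unfold ThresholdIneq
  rw [thresholdSum_top_eq' N q (by omega), card_top_demanding' hq hcf hB hlong hR,
    card_top_targets' hq hcf hB hlong hR]
  have hs := card_sdiff_add_eq_rk' hlong
  have hBl := card_Bl_le_A2' (N := N) (q := q) B
  have hA := card_A_le_A2' (N := N) B hs
  set A := ((clF N B).powerset.filter
    (fun D => rk N D = q - 1 ∧ rk N ((gr N \ clF N B) ∪ (clF N B \ D)) = rk N (gr N))).card with hAdef
  set A2 := ((clF N B).powerset.filter (fun D => rk N D = q - 1 ∧ q - 2 ≤ rk N (clF N B \ D))).card with hA2def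
  set Bl := ((clF N B).powerset.filter (fun D => rk N D = q - 2 ∧ rk N (clF N B \ D) = q - 1)).card with hBldef
  set C2 := ((clF N B).powerset.filter
    (fun D => rk N ((gr N \ clF N B) ∪ D) = q ∧ rk N (clF N B \ D) = q - 1)).card with hC2def
  set s := (gr N \ clF N B).card with hsdef
  set R := rk N (gr N) with hRdef
  by_cases hs2 : s = 2
  · -- `s = 2`: `A = C₂` and `Bℓ ≤ A₂`
    have hRq : R = q := by omega
    have hAC : A = C2 := card_A_eq_C2' (N := N) B hRq
    rw [if_pos hs2, hs2, ← hAC, hRq]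
    norm_num
    apply Nat.mul_le_mul_left
    omega
  · rw [if_neg hs2]
    obtain ⟨m, hm⟩ : ∃ m, s = m + 3 := ⟨s - 3, by omega⟩
    obtain ⟨n, hn⟩ : ∃ n, q = n + 2 := ⟨q - 2, by omega⟩
    have hR' : R = m + 3 + n := by omega
    have hc : 2 * s.choose 2 = (m + 3) * (m + 2) := by
      rw [two_mul_choose_two, hm]
      exact congrArg ((m + 3) * ·) (by omega)
    rw [hR', hm, hn]
    rw [hm] at hc
    exact top_arith m n A A2 Bl _ hA hBl hc

end TopLongFlat

end PercRepro.Cogirth
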